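import Literature.Topology.FourManifolds.MTorusPoints
import Literature.Topology.FourManifolds.SmoothEmbeddingCriteria
import Mathlib.Geometry.Manifold.LocalDiffeomorph
import HarnessLib

/-!
# Exponential coordinates on the glued mapping torus are local diffeomorphisms

Infrastructure for the explicit fishtail neighbourhood (R. Gompf, *More Cappell–Shaneson spheres
are standard*, Algebr. Geom. Topol. 10 (2010), Lemma 2.2 as used in the proof of Thm 2.1; the named
fact `Literature.Topology.FourManifolds.gompf2010_framedTwist`). The embedding of the fishtail end
model is written in real coordinates `(θ₁, θ₂, θ₃, s)`, read in the mapping torus `X_ψ` through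
`Literature.Topology.FourManifolds.mtCoord ψ (v, s) = mtPt ψ (expT v) s`
(`MTorusPoints.lean`, `TorusCoordinates.lean`). To transfer local-diffeomorphism statements from
`ℝ⁴` to `X_ψ` one needs that these coordinates are themselves local diffeomorphisms:

* `Literature.Topology.FourManifolds.isLocalDiffeomorphAt_of_isSmoothEmbedding` — an open smooth
  embedding is a local diffeomorphism (Lee, Prop. 5.2 / Thm. 4.14; the inverse is smooth on the
  range by `contMDiffOn_symm_of_isSmoothEmbedding`);
* `Literature.Topology.FourManifolds.PartialDiffeomorph.prod'` and
  `Literature.Topology.FourManifolds.IsLocalDiffeomorphAt.prodMap'` — products;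
* `Literature.Topology.FourManifolds.expT_add`, `Literature.Topology.FourManifolds.mulLeftT` (left
  translation of `T³` as a diffeomorphism), `Literature.Topology.FourManifolds.expTPartialDiffeomorph`
  (`expT` on the open cube `(-π, π)³` with inverse `logT`) and
  `Literature.Topology.FourManifolds.isLocalDiffeomorphAt_expT` — **`expT : ℝ³ → T³` is a local
  diffeomorphism at every point**;
* `Literature.Topology.FourManifolds.pieceTwoMk`, `Literature.Topology.FourManifolds.pieceOneMk` —
  the identity of `ℝ` onto the open pieces `(1/2, 3/2)`, `(0, 1)` as partial diffeomorphisms;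
* `Literature.Topology.FourManifolds.isLocalDiffeomorphAt_mtCoord` — **the coordinates
  `(v, s) ↦ mtPt ψ (expT v) s` are a local diffeomorphism at every `(v, s)` with `0 < s < 3/2`**.

Everything is proved; no named facts.

## References

* J. M. Lee, *Introduction to Smooth Manifolds*, 2nd ed. (2013), Prop. 5.2, Thm. 4.14. [LeeSmoothManifolds2013]
* R. E. Gompf, *More Cappell–Shaneson spheres are standard*, Algebr. Geom. Topol. 10 (2010)
  1665–1681, §2 ¶1 and Lemma 2.2. [GompfAGT2010]
-/

noncomputable section

open scoped Manifold ContDiff Topology Real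
open Set Function Filter

namespace Literature.Topology.FourManifolds

local notation "𝔼" n => EuclideanSpace ℝ (Fin n)
local notation "𝓣" =>
  (ModelWithCorners.prod (𝓡 1) (ModelWithCorners.prod (𝓡 1) (𝓡 1)))


/-! ### Local diffeomorphisms only depend on the germ -/

section Germ

variable {E : Type*} [NormedAddCommGroup E] [NormedSpace ℝ E] {H : Type*} [TopologicalSpace H]
  {I : ModelWithCorners ℝ E H} {M : Type*} [TopologicalSpace M] [ChartedSpace H M]
  {E' : Type*} [NormedAddCommGroup E'] [NormedSpace ℝ E'] {H' : Type*} [TopologicalSpace H']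
  {J : ModelWithCorners ℝ E' H'} {N : Type*} [TopologicalSpace N] [ChartedSpace H' N] {m : WithTop ℕ∞}

/-- Restriction of a partial diffeomorphism to an open set. [folklore] -/
def PartialDiffeomorph.restrOpen' (Φ : _root_.PartialDiffeomorph I J M N m) (s : Set M)
    (hs : IsOpen s) : _root_.PartialDiffeomorph I J M N m where
  toPartialEquiv := Φ.toPartialEquiv.restr s
  open_source := (Φ.toOpenPartialHomeomorph.restrOpen s hs).open_source
  open_target := (Φ.toOpenPartialHomeomorph.restrOpen s hs).open_target
  contMDiffOn_toFun := Φ.contMDiffOn_toFun.mono inter_subset_left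
  contMDiffOn_invFun := Φ.contMDiffOn_invFun.mono inter_subset_left

/-- **Being a local diffeomorphism at `x` only depends on the germ at `x`** (as in
`Literature.Geometry.Riemannian.isLocalDiffeomorphAt_congr_of_eventuallyEq`, repeated to keep the
import closure small). [folklore] -/
theorem isLocalDiffeomorphAt_congr_nhds' {f g : M → N} {x : M}
    (hf : IsLocalDiffeomorphAt I J m f x) (h : g =ᶠ[𝓝 x] f) : IsLocalDiffeomorphAt I J m g x := by
  obtain ⟨Φ, hx, heq⟩ := hf
  obtain ⟨s, hs, hso, hxs⟩ := mem_nhds_iff.1 h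
  refine ⟨PartialDiffeomorph.restrOpen' Φ s hso, ⟨hx, hxs⟩, ?_⟩
  rintro y ⟨hy, hys⟩
  change g y = Φ y
  rw [hs hys, heq hy]

end Germ

/-! ### Open smooth embeddings are local diffeomorphisms -/

section OpenEmb

variable {E H E' H' : Type*} [NormedAddCommGroup E] [NormedSpace ℝ E] [TopologicalSpace H]
  [NormedAddCommGroup E'] [NormedSpace ℝ E'] [TopologicalSpace H']
  {I : ModelWithCorners ℝ E H} {J : ModelWithCorners ℝ E' H'}
  {M : Type*} [TopologicalSpace M] [ChartedSpace H M]
  {N : Type*} [TopologicalSpace N] [ChartedSpace H' N]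

/-- **An open smooth embedding is a local diffeomorphism** (its inverse is smooth on the open
range, `contMDiffOn_symm_of_isSmoothEmbedding`). [cite: LeeSmoothManifolds2013, Prop. 5.2 and Thm. 4.14] -/
theorem isLocalDiffeomorphAt_of_isSmoothEmbedding [I.Boundaryless] [J.Boundaryless] {f : M → N}
    (hf : Manifold.IsSmoothEmbedding I J ∞ f) (ho : IsOpen (range f)) (a : M) :
    IsLocalDiffeomorphAt I J ∞ f a := by
  haveI : Nonempty M := ⟨a⟩
  have hoe : Topology.IsOpenEmbedding f := Topology.IsOpenEmbedding.mk hf.isEmbedding ho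
  let Φ : PartialDiffeomorph I J M N ∞ :=
    { toPartialEquiv := (hoe.toOpenPartialHomeomorph f).toPartialEquiv
      open_source := (hoe.toOpenPartialHomeomorph f).open_source
      open_target := (hoe.toOpenPartialHomeomorph f).open_target
      contMDiffOn_toFun := hf.contMDiff.contMDiffOn
      contMDiffOn_invFun := by
        have h := contMDiffOn_symm_of_isSmoothEmbedding hf hoe
        have ht : (hoe.toOpenPartialHomeomorph f).target = range f := by simp
        rw [show (hoe.toOpenPartialHomeomorph f).toPartialEquiv.target = range f from ht]
        exact h }
  exact ⟨Φ, by simp [Φ], fun _ _ ↦ rfl⟩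

end OpenEmb

/-! ### Products of partial diffeomorphisms -/

section Prod

variable {E₁ H₁ E₂ H₂ E₃ H₃ E₄ H₄ : Type*}
  [NormedAddCommGroup E₁] [NormedSpace ℝ E₁] [TopologicalSpace H₁]
  [NormedAddCommGroup E₂] [NormedSpace ℝ E₂] [TopologicalSpace H₂]
  [NormedAddCommGroup E₃] [NormedSpace ℝ E₃] [TopologicalSpace H₃]
  [NormedAddCommGroup E₄] [NormedSpace ℝ E₄] [TopologicalSpace H₄]
  {I₁ : ModelWithCorners ℝ E₁ H₁} {I₂ : ModelWithCorners ℝ E₂ H₂}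
  {I₃ : ModelWithCorners ℝ E₃ H₃} {I₄ : ModelWithCorners ℝ E₄ H₄}
  {M₁ : Type*} [TopologicalSpace M₁] [ChartedSpace H₁ M₁]
  {M₂ : Type*} [TopologicalSpace M₂] [ChartedSpace H₂ M₂]
  {M₃ : Type*} [TopologicalSpace M₃] [ChartedSpace H₃ M₃]
  {M₄ : Type*} [TopologicalSpace M₄] [ChartedSpace H₄ M₄]
  {n : WithTop ℕ∞}

/-- **The product of two partial diffeomorphisms.** [folklore] -/
def PartialDiffeomorph.prod' (Φ : PartialDiffeomorph I₁ I₂ M₁ M₂ n) (Ψ : PartialDiffeomorph I₃ I₄ M₃ M₄ n) :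
    PartialDiffeomorph (I₁.prod I₃) (I₂.prod I₄) (M₁ × M₃) (M₂ × M₄) n where
  toPartialEquiv := Φ.toPartialEquiv.prod Ψ.toPartialEquiv
  open_source := Φ.open_source.prod Ψ.open_source
  open_target := Φ.open_target.prod Ψ.open_target
  contMDiffOn_toFun := (Φ.contMDiffOn_toFun.prodMap Ψ.contMDiffOn_toFun)
  contMDiffOn_invFun := (Φ.contMDiffOn_invFun.prodMap Ψ.contMDiffOn_invFun)

/-- **The product of two local diffeomorphisms is a local diffeomorphism.** [folklore] -/
theorem IsLocalDiffeomorphAt.prodMap' {f : M₁ → M₂} {g : M₃ → M₄} {x : M₁} {y : M₃}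
    (hf : IsLocalDiffeomorphAt I₁ I₂ n f x) (hg : IsLocalDiffeomorphAt I₃ I₄ n g y) :
    IsLocalDiffeomorphAt (I₁.prod I₃) (I₂.prod I₄) n (Prod.map f g) (x, y) := by
  obtain ⟨Φ, hx, hΦ⟩ := hf
  obtain ⟨Ψ, hy, hΨ⟩ := hg
  refine ⟨PartialDiffeomorph.prod' Φ Ψ, ⟨hx, hy⟩, ?_⟩
  rintro ⟨x', y'⟩ ⟨hx', hy'⟩
  exact Prod.ext (hΦ hx') (hΨ hy')

end Prod

/-! ### `expT` is a local diffeomorphism -/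

section ExpT

/-- `expT` is a homomorphism: `expT (v + w) = expT v * expT w`. [folklore] -/
theorem expT_add (v w : 𝔼 3) : expT (v + w) = expT v * expT w := by
  simp only [expT, PiLp.add_apply, Circle.exp_add]
  rfl

/-- **Left translation of `T³`** by `c`, a diffeomorphism. [folklore] -/
def mulLeftT (c : ThreeTorus) : ThreeTorus ≃ₘ⟮𝓣, 𝓣⟯ ThreeTorus where
  toFun z := c * z
  invFun z := c⁻¹ * z
  left_inv z := by simp
  right_inv z := by simp
  contMDiff_toFun := by
    show ContMDiff 𝓣 𝓣 ∞ fun z : ThreeTorus ↦ (c.1 * z.1, c.2.1 * z.2.1, c.2.2 * z.2.2)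
    have h1 : ContMDiff (𝓡 1) (𝓡 1) ∞ fun w : Circle ↦ c.1 * w := contMDiff_mul_left.of_le le_top
    have h2 : ContMDiff (𝓡 1) (𝓡 1) ∞ fun w : Circle ↦ c.2.1 * w := contMDiff_mul_left.of_le le_top
    have h3 : ContMDiff (𝓡 1) (𝓡 1) ∞ fun w : Circle ↦ c.2.2 * w := contMDiff_mul_left.of_le le_top
    exact h1.prodMap (h2.prodMap h3)
  contMDiff_invFun := by
    show ContMDiff 𝓣 𝓣 ∞ fun z : ThreeTorus ↦ (c⁻¹.1 * z.1, c⁻¹.2.1 * z.2.1, c⁻¹.2.2 * z.2.2)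
    have h1 : ContMDiff (𝓡 1) (𝓡 1) ∞ fun w : Circle ↦ c⁻¹.1 * w := contMDiff_mul_left.of_le le_top
    have h2 : ContMDiff (𝓡 1) (𝓡 1) ∞ fun w : Circle ↦ c⁻¹.2.1 * w := contMDiff_mul_left.of_le le_top
    have h3 : ContMDiff (𝓡 1) (𝓡 1) ∞ fun w : Circle ↦ c⁻¹.2.2 * w := contMDiff_mul_left.of_le le_top
    exact h1.prodMap (h2.prodMap h3)

/-- The value of `mulLeftT`. [folklore] -/
@[simp] theorem mulLeftT_apply (c z : ThreeTorus) : mulLeftT c z = c * z := rfl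

/-- The open cube `(-π, π)³`. [folklore] -/
def expCube : Set (𝔼 3) := {v | ∀ j, |v j| < π}

/-- The cube is open. [folklore] -/
theorem isOpen_expCube : IsOpen expCube := by
  have : expCube = ⋂ j : Fin 3, {v : 𝔼 3 | |v j| < π} := by ext v; simp [expCube]
  rw [this]
  exact isOpen_iInter_of_finite fun j ↦
    isOpen_lt (continuous_abs.comp (PiLp.continuous_apply 2 _ j)) continuous_const

/-- For `z` in the slit torus, `logT z` lies in the open cube. [folklore] -/
theorem logT_mem_expCube {z : ThreeTorus} (hz : z ∈ torusSlit) : logT z ∈ expCube := fun j ↦ by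
  have h := hz j
  rw [Complex.mem_slitPlane_iff_arg] at h
  have h1 := Complex.neg_pi_lt_arg (torusCoord z j : ℂ)
  have h2 := Complex.arg_le_pi (torusCoord z j : ℂ)
  simp only [logT, PiLp.toLp_apply]
  exact abs_lt.2 ⟨h1, lt_of_le_of_ne h2 h.1⟩

/-- **`expT` on the open cube, with inverse `logT` on the slit torus**, as a partial
diffeomorphism. [folklore] -/
def expTPartialDiffeomorph : PartialDiffeomorph 𝓘(ℝ, 𝔼 3) 𝓣 (𝔼 3) ThreeTorus ∞ where
  toFun := expT
  invFun := logT
  source := expCube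
  target := torusSlit
  map_source' _ hv := expT_mem_torusSlit hv
  map_target' _ hz := logT_mem_expCube hz
  left_inv' _ hv := logT_expT_of_abs_lt hv
  right_inv' z _ := expT_logT z
  open_source := isOpen_expCube
  open_target := isOpen_torusSlit
  contMDiffOn_toFun := contMDiff_expT.contMDiffOn
  contMDiffOn_invFun := contMDiffOn_logT

/-- Translation `w ↦ w - v` of `ℝ³`, a diffeomorphism. [folklore] -/
def subConstDiffeo (v : 𝔼 3) : (𝔼 3) ≃ₘ⟮𝓘(ℝ, 𝔼 3), 𝓘(ℝ, 𝔼 3)⟯ (𝔼 3) where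
  toFun w := w - v
  invFun w := w + v
  left_inv w := by simp
  right_inv w := by simp
  contMDiff_toFun := contMDiff_iff_contDiff.2 (contDiff_id.sub contDiff_const)
  contMDiff_invFun := contMDiff_iff_contDiff.2 (contDiff_id.add contDiff_const)

/-- **`expT : ℝ³ → T³` is a local diffeomorphism at every point** (at `0` by the cube chart, in
general by translation: `expT w = expT v · expT (w - v)`). [folklore] -/
theorem isLocalDiffeomorphAt_expT (v : 𝔼 3) : IsLocalDiffeomorphAt 𝓘(ℝ, 𝔼 3) 𝓣 ∞ expT v := by
  have h1 : IsLocalDiffeomorphAt 𝓘(ℝ, 𝔼 3) 𝓘(ℝ, 𝔼 3) ∞ (subConstDiffeo v) v :=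
    (subConstDiffeo v).isLocalDiffeomorph v
  have h2 : IsLocalDiffeomorphAt 𝓘(ℝ, 𝔼 3) 𝓣 ∞ expT (subConstDiffeo v v) := by
    have h0 : subConstDiffeo v v = 0 := sub_self v
    rw [h0]
    have hmem : (0 : 𝔼 3) ∈ expCube := fun j ↦ by simp [Real.pi_pos]
    exact PartialDiffeomorph.isLocalDiffeomorphAt 𝓘(ℝ, 𝔼 3) 𝓣 ∞ expTPartialDiffeomorph hmem
  have h3 : IsLocalDiffeomorphAt 𝓣 𝓣 ∞ (mulLeftT (expT v)) (expT (subConstDiffeo v v)) :=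
    (mulLeftT (expT v)).isLocalDiffeomorph _
  have h := (h1.comp (K := 𝓣) (P := ThreeTorus) h2).comp (K := 𝓣) (P := ThreeTorus) h3
  have heq : (mulLeftT (expT v)) ∘ (expT ∘ (subConstDiffeo v)) = expT := by
    funext w
    show expT v * expT (w - v) = expT w
    rw [← expT_add, add_sub_cancel]
  rw [← heq]
  exact h

end ExpT

/-! ### The open pieces of the base -/

section Pieces

/-- The identity of `ℝ` onto the second piece `(1/2, 3/2)` (junk `1` outside). [folklore] -/
def pieceTwoFun (t : ℝ) : ↥mappingTorusPieceTwo :=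
  if h : 1 / 2 < t ∧ t < 3 / 2 then ⟨t, mem_mappingTorusPieceTwo.2 h⟩ else ⟨1, one_mem_pieceTwo⟩

/-- On the piece, `pieceTwoFun t = t`. [folklore] -/
theorem coe_pieceTwoFun {t : ℝ} (h : 1 / 2 < t ∧ t < 3 / 2) : (pieceTwoFun t : ℝ) = t := by
  rw [pieceTwoFun, dif_pos h]

/-- The identity of `ℝ` onto the first piece `(0, 1)` (junk `1/2` outside). [folklore] -/
def pieceOneFun (s : ℝ) : ↥mappingTorusPieceOne :=
  if h : 0 < s ∧ s < 1 then ⟨s, mem_mappingTorusPieceOne.2 h⟩ else ⟨1 / 2, half_mem_pieceOne⟩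

/-- On the piece, `pieceOneFun s = s`. [folklore] -/
theorem coe_pieceOneFun {s : ℝ} (h : 0 < s ∧ s < 1) : (pieceOneFun s : ℝ) = s := by
  rw [pieceOneFun, dif_pos h]

/-- **The second piece as a partial diffeomorphism** `ℝ ⊇ (1/2, 3/2) ≅ piece two`. [folklore] -/
def pieceTwoMk : PartialDiffeomorph 𝓘(ℝ, ℝ) 𝓘(ℝ, ℝ) ℝ ↥mappingTorusPieceTwo ∞ where
  toFun := pieceTwoFun
  invFun := Subtype.val
  source := Ioo (1 / 2) (3 / 2)
  target := univ
  map_source' _ _ := mem_univ _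
  map_target' t _ := mem_mappingTorusPieceTwo.1 t.2
  left_inv' _ ht := coe_pieceTwoFun ht
  right_inv' t _ := Subtype.ext (coe_pieceTwoFun (mem_mappingTorusPieceTwo.1 t.2))
  open_source := isOpen_Ioo
  open_target := isOpen_univ
  contMDiffOn_toFun := by
    intro t ht
    rw [← ContMDiffWithinAt.subtypeVal_comp_iff]
    refine contMDiffWithinAt_id.congr (fun t' ht' ↦ coe_pieceTwoFun ht') (coe_pieceTwoFun ht)
  contMDiffOn_invFun := contMDiff_subtype_val.contMDiffOn

/-- **The first piece as a partial diffeomorphism** `ℝ ⊇ (0, 1) ≅ piece one`. [folklore] -/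
def pieceOneMk : PartialDiffeomorph 𝓘(ℝ, ℝ) 𝓘(ℝ, ℝ) ℝ ↥mappingTorusPieceOne ∞ where
  toFun := pieceOneFun
  invFun := Subtype.val
  source := Ioo 0 1
  target := univ
  map_source' _ _ := mem_univ _
  map_target' s _ := mem_mappingTorusPieceOne.1 s.2
  left_inv' _ hs := coe_pieceOneFun hs
  right_inv' s _ := Subtype.ext (coe_pieceOneFun (mem_mappingTorusPieceOne.1 s.2))
  open_source := isOpen_Ioo
  open_target := isOpen_univ
  contMDiffOn_toFun := by
    intro s hs
    rw [← ContMDiffWithinAt.subtypeVal_comp_iff]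
    refine contMDiffWithinAt_id.congr (fun s' hs' ↦ coe_pieceOneFun hs') (coe_pieceOneFun hs)
  contMDiffOn_invFun := contMDiff_subtype_val.contMDiffOn

end Pieces

/-! ### The exponential coordinates of the mapping torus -/

section Coord

variable (ψ : ThreeTorus ≃ₘ⟮𝓣, 𝓣⟯ ThreeTorus)

/-- **Exponential coordinates of the mapping torus**: `(v, s) ↦ [expT v, s]`. [cite: GompfAGT2010, §2 (X_φ = T³ × ℝ/(x,s) ∼ (φx, s+1))] -/
def mtCoord (q : (𝔼 3) × ℝ) : MTorus ψ := mtPt ψ (expT q.1) q.2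

variable {ψ}

/-- On `(1/2, 3/2)` the coordinates factor through the second cylinder. [folklore] -/
theorem mtCoord_eq_inr {q : (𝔼 3) × ℝ} (h : 1 / 2 < q.2 ∧ q.2 < 3 / 2) :
    mtCoord ψ q = (mtGlueData ψ).inr (Prod.map expT pieceTwoFun q) := by
  rw [mtCoord, mtPt_of_mem_two _ h]
  congr 2
  exact Subtype.ext (coe_pieceTwoFun h).symm

/-- On `(0, 1)` the coordinates factor through the first cylinder. [folklore] -/
theorem mtCoord_eq_inl {q : (𝔼 3) × ℝ} (h : 0 < q.2 ∧ q.2 < 1) :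
    mtCoord ψ q = (mtGlueData ψ).inl (Prod.map expT pieceOneFun q) := by
  rw [mtCoord, mtPt_of_mem_one _ h]
  congr 2
  exact Subtype.ext (coe_pieceOneFun h).symm

/-- **The exponential coordinates are a local diffeomorphism** at every `(v, s)` with
`0 < s < 3/2`. [folklore] -/
theorem isLocalDiffeomorphAt_mtCoord {q : (𝔼 3) × ℝ} (h0 : 0 < q.2) (h1 : q.2 < 3 / 2) :
    IsLocalDiffeomorphAt (𝓘(ℝ, 𝔼 3).prod 𝓘(ℝ, ℝ)) 𝓘(ℝ, 𝔼 4) ∞ (mtCoord ψ) q := by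
  by_cases h2 : 1 / 2 < q.2
  · -- second cylinder
    have hq : 1 / 2 < q.2 ∧ q.2 < 3 / 2 := ⟨h2, h1⟩
    have hA : IsLocalDiffeomorphAt (𝓘(ℝ, 𝔼 3).prod 𝓘(ℝ, ℝ)) (ModelWithCorners.prod 𝓣 𝓘(ℝ, ℝ)) ∞
        (Prod.map expT pieceTwoFun) q := by
      exact IsLocalDiffeomorphAt.prodMap' (isLocalDiffeomorphAt_expT q.1)
        (PartialDiffeomorph.isLocalDiffeomorphAt 𝓘(ℝ, ℝ) 𝓘(ℝ, ℝ) ∞ pieceTwoMk (x := q.2) hq)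
    have hB : IsLocalDiffeomorphAt (ModelWithCorners.prod 𝓣 𝓘(ℝ, ℝ)) 𝓘(ℝ, 𝔼 4) ∞ (mtGlueData ψ).inr
        (Prod.map expT pieceTwoFun q) :=
      isLocalDiffeomorphAt_of_isSmoothEmbedding (mtGlueData ψ).isSmoothEmbedding_inr (mtGlueData ψ).isOpen_range_inr _
    have h := hA.comp (K := 𝓘(ℝ, 𝔼 4)) (P := MTorus ψ) hB
    refine isLocalDiffeomorphAt_congr_nhds' h ?_
    have hopen : IsOpen {q' : (𝔼 3) × ℝ | 1 / 2 < q'.2 ∧ q'.2 < 3 / 2} :=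
      (isOpen_lt continuous_const continuous_snd).inter (isOpen_lt continuous_snd continuous_const)
    filter_upwards [hopen.mem_nhds hq] with q' hq'
    exact mtCoord_eq_inr hq'
  · -- first cylinder
    rw [not_lt] at h2
    have hq : 0 < q.2 ∧ q.2 < 1 := ⟨h0, by linarith⟩
    have hA : IsLocalDiffeomorphAt (𝓘(ℝ, 𝔼 3).prod 𝓘(ℝ, ℝ)) (ModelWithCorners.prod 𝓣 𝓘(ℝ, ℝ)) ∞
        (Prod.map expT pieceOneFun) q := by
      exact IsLocalDiffeomorphAt.prodMap' (isLocalDiffeomorphAt_expT q.1)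
        (PartialDiffeomorph.isLocalDiffeomorphAt 𝓘(ℝ, ℝ) 𝓘(ℝ, ℝ) ∞ pieceOneMk (x := q.2) hq)
    have hB : IsLocalDiffeomorphAt (ModelWithCorners.prod 𝓣 𝓘(ℝ, ℝ)) 𝓘(ℝ, 𝔼 4) ∞ (mtGlueData ψ).inl
        (Prod.map expT pieceOneFun q) :=
      isLocalDiffeomorphAt_of_isSmoothEmbedding (mtGlueData ψ).isSmoothEmbedding_inl (mtGlueData ψ).isOpen_range_inl _
    have h := hA.comp (K := 𝓘(ℝ, 𝔼 4)) (P := MTorus ψ) hB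
    refine isLocalDiffeomorphAt_congr_nhds' h ?_
    have hopen : IsOpen {q' : (𝔼 3) × ℝ | 0 < q'.2 ∧ q'.2 < 1} :=
      (isOpen_lt continuous_const continuous_snd).inter (isOpen_lt continuous_snd continuous_const)
    filter_upwards [hopen.mem_nhds hq] with q' hq'
    exact mtCoord_eq_inl hq'

end Coord

end Literature.Topology.FourManifolds
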